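import Summits.NavierStokesRegularity.NavierStokesRegularity.Theorems.SwirlDecrementLaw
import HarnessLib.Audit
import HarnessLib

/-!
# SwirlDecrementLaw, part 2 — the Burgers witness package and the refutations (ROUND-14, seat nsreg-p2)

Second half of planner nsreg-p2's `R14-SwirlDecrementLaw.lean` (split for the 400-line rule; see the
module docstring of `…Theorems.SwirlDecrementLaw` for the mechanism and the sources).  The classical
facts about the steady Burgers vortex are packaged as ONE named statement `BurgersWitnessWith D`
(energy constant `D`; `BurgersWitness` = the sharp `D = 2π/5`; typing request T-14.2b targets the
cheap `D = 4π/3`), used as a HYPOTHESIS; everything downstream is kernel-checked: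
`burgers_ceilingWith` (`Λ(D·S² + 1) ≤ 2e^{-S/64}` for every admissible law `Λ` and `S ≥ 8`),
`not_polyDecrementLaw_of_burgersWith` (no polynomial law, any `p > 0`, any `D ≥ 0`),
`not_expDecrementLaw_of_burgersWith` (no exponential law with `θ < 1/2`), and the side-by-side
summary `driftLadder_summaryWith` (with Chen–Tsai–Zhang's located `ExpDecrementLaw 8` as the other
hypothesis): the exponent of the one-scale swirl decrement law lies in `[1/2, 8]`.

Memo: `run/shared/lean/pub/ns-regularity-ideate/ns-regularity-ideate-p2/ROUND-14.md` §1d, §2 (S3), (S4).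
WHAT THIS IS NOT: not NS regularity; a ceiling on a METHOD FAMILY (ladder C of ROUND-13) plus the
refutation of a never-printed natural law, modulo the classical Burgers facts; hard cores untouched.
-/

namespace Summit.NavierStokesRegularity.NavierStokesRegularity.Theorems.SwirlDecrementLaw

open MeasureTheory Set Filter Topology Metric
open scoped ENNReal NNReal
open Literature.Analysis.FluidPDE Literature.Analysis.FluidPDE.ChenTsaiZhang2022


noncomputable section

/-! ## 3. The Burgers facts as one named classical statement, and the refutations -/

/-- The axis point used by the witness: `z_B = (-1/128, 0) ∈ Q(1/8)`. -/
def burgersAxisPoint : ℝ × (EuclideanSpace ℝ (Fin 3)) := ((-(1 / 128) : ℝ), (0 : (EuclideanSpace ℝ (Fin 3))))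

/-- `z_B ∈ Q(1/8)`. -/
theorem burgersAxisPoint_mem : burgersAxisPoint ∈ parabolicCylinder (1 / 8) (0 : ℝ × (EuclideanSpace ℝ (Fin 3))) := by
  simp only [parabolicCylinder, burgersAxisPoint, Set.mem_prod, Set.mem_Ioo, Prod.fst_zero,
    Prod.snd_zero, Metric.mem_ball, dist_self]
  norm_num

/-- `z_B` lies on the axis. -/
theorem cylRadius_burgersAxisPoint : cylRadius burgersAxisPoint.2 = 0 :=
  (cylRadius_eq_zero_iff _).2 ⟨rfl, rfl⟩

/-- **THE BURGERS WITNESS, energy constant `D`** — classical facts about the steady Burgers vortex,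
packaged as ONE named statement (TRUE classically for every `D ≥ 2π/5`; typing request T-14.2b).
For every `S ≥ 8` take strain `s = 16 S` and circulation constant `G = 1/s`:
`u(x) = s(-x₁/2, -x₂/2, x₃) + W(r)(-x₂, x₁, 0)`, `W(r) = G(1 - e^{-s r²/4})/r²` (real-analytic in `r²`),
`p = -s²(r²/4 + x₃²)/2 + ∫₀ʳ ρ W(ρ)² dρ` (steady, smooth, axisymmetric, Navier–Stokes with `ν = 1`;
Burgers 1948).  At the axis point `z_B = (-1/128, 0)` and scale `R = 1/4` (`S = sR²`):
(i) scaled energy `A(z_B, 1/4) ≤ D S² + 1` — SHARP constant `D = 2π/5` (`|u|² = s²(r²/4 + x₃²) + W²r²`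
exactly, `∫_{B_R} x_i² = (4π/15)R⁵`, swirl part `≤ 1`); CHEAP constant `D = 4π/3` (pointwise
`|u|² ≤ s²|x|² + 1/16` on `B_R` since `W ≤ Gs/4 = 1/4`, times `|B_R| = 4πR³/3`) — the cheap one is
what a prover should type first (`isSuitableWeakSolutionInBall_of_classical'` +
`IsClassicalNSSolutionOnRegion` of the explicit field, cf. `quadFlow_isClassical`);
(ii) the swirl `Γ = r²W = G(1 - e^{-s r²/4}) ∈ [0, G(1 - e^{-S/4})]` on `Q(z_B, 1/4)` (`r < 1/4`);
(iii) on `Q(z_B, 1/16)` the swirl is not a.e. confined to any interval shorter than `G(1 - e^{-S/64})`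
(it is continuous with range `[0, G(1 - e^{-s/1024}))` there, `s/1024 = S/64`). -/
def BurgersWitnessWith (D : ℝ) : Prop :=
  ∀ S : ℝ, 8 ≤ S → ∃ (u : ℝ → (EuclideanSpace ℝ (Fin 3)) → (EuclideanSpace ℝ (Fin 3))) (p : ℝ → (EuclideanSpace ℝ (Fin 3)) → ℝ) (G : ℝ), 0 < G ∧
    IsSuitableWeakSolutionInBall 1 0 u p ∧
    (∀ t ∈ Ioo (-1 : ℝ) 0, IsAxisymmetric (u t)) ∧
    (∀ t ∈ Ioo (-1 : ℝ) 0, IsAxisymmetricScalar (p t)) ∧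
    cknA (1 / 4) burgersAxisPoint u ≤ ENNReal.ofReal (D * S ^ 2 + 1) ∧
    (∀ᵐ z ∂(volume.restrict (parabolicCylinder (1 / 4) burgersAxisPoint)),
        swirl (u z.1) z.2 ∈ Icc 0 (G * (1 - Real.exp (-(S / 4))))) ∧
    (∀ a' b' : ℝ,
      (∀ᵐ z ∂(volume.restrict (parabolicCylinder (1 / 4 / 4) burgersAxisPoint)),
        swirl (u z.1) z.2 ∈ Icc a' b') →
      G * (1 - Real.exp (-(S / 64))) ≤ b' - a')

/-- **THE BURGERS WITNESS** with the sharp energy constant `2π/5`. -/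
def BurgersWitness : Prop := BurgersWitnessWith (2 * Real.pi / 5)

/-- Unfolding `BurgersWitness`. -/
theorem burgersWitness_iff : BurgersWitness ↔ BurgersWitnessWith (2 * Real.pi / 5) := Iff.rfl

/-- A witness with a smaller energy constant is a witness with any larger one. -/
theorem BurgersWitnessWith.mono {D D' : ℝ} (hDD' : D ≤ D') (h : BurgersWitnessWith D) :
    BurgersWitnessWith D' := by
  intro S hS
  obtain ⟨u, q, G, hG, hsws, haxi, haxip, hA, hconf, hspread⟩ := h S hS
  refine ⟨u, q, G, hG, hsws, haxi, haxip, hA.trans (ENNReal.ofReal_le_ofReal ?_), hconf, hspread⟩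
  nlinarith [sq_nonneg S]

/-- **THE BURGERS CEILING.**  Given the Burgers facts with energy constant `D ≥ 0`, EVERY one-scale
swirl decrement law has `Λ(D S² + 1) ≤ 2 e^{-S/64}` for all `S ≥ 8`: in terms of the scaled energy
`A`, no admissible profile exceeds `2 exp(-c A^{1/2})`, `c = D^{-1/2}/64`.  The exponent `θ` of
`ExpDecrementLaw θ` therefore lies in `[1/2, 8]`; which value is the truth is OPEN. -/
theorem burgers_ceilingWith {D : ℝ} (hD : 0 ≤ D) (hB : BurgersWitnessWith D) {Λ : ℝ → ℝ}
    (hlaw : SwirlDecrementLaw Λ) {S : ℝ} (hS : 8 ≤ S) :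
    Λ (D * S ^ 2 + 1) ≤ 2 * Real.exp (-(S / 64)) := by
  obtain ⟨u, q, G, hG, hsws, haxi, haxip, hA, hconf, hspread⟩ := hB S hS
  have hE4 : Real.exp (-(S / 4)) ≤ 1 / 2 := exp_neg_quarter_le_half hS
  have h4 : 0 ≤ Real.exp (-(S / 4)) := (Real.exp_pos _).le
  have h64 : 0 < Real.exp (-(S / 64)) := Real.exp_pos _
  have hb : (0 : ℝ) ≤ G * (1 - Real.exp (-(S / 4))) := mul_nonneg hG.le (by linarith)
  have hM : (0 : ℝ) ≤ D * S ^ 2 + 1 := by positivity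
  obtain ⟨a', b', -, hconf', hdec⟩ :=
    hlaw u q hsws haxi haxip burgersAxisPoint burgersAxisPoint_mem cylRadius_burgersAxisPoint
      (1 / 4) (by norm_num) le_rfl (D * S ^ 2 + 1) hM hA 0 _ hb hconf
  have hsp := hspread a' b' hconf'
  rw [sub_zero] at hdec
  by_cases hlam0 : 0 ≤ Λ (D * S ^ 2 + 1)
  swap
  · linarith
  have k1 : Λ (D * S ^ 2 + 1) * (G * (1 - Real.exp (-(S / 4)))) ≤
      G * Real.exp (-(S / 64)) := by
    nlinarith [hsp, hdec, mul_nonneg hG.le h4]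
  have k2 : Λ (D * S ^ 2 + 1) * G ≤ 2 * Real.exp (-(S / 64)) * G := by
    nlinarith [k1, mul_nonneg hlam0 hG.le]
  exact le_of_mul_le_mul_right k2 hG

/-- The Burgers ceiling with the sharp constant `2π/5`. -/
theorem burgers_ceiling (hB : BurgersWitness) {Λ : ℝ → ℝ} (hlaw : SwirlDecrementLaw Λ) {S : ℝ}
    (hS : 8 ≤ S) : Λ (2 * Real.pi / 5 * S ^ 2 + 1) ≤ 2 * Real.exp (-(S / 64)) :=
  burgers_ceilingWith (by positivity) hB hlaw hS

/-- **EVERY POLYNOMIAL DECREMENT LAW IS FALSE** (given the Burgers facts with any constant `D ≥ 0`). -/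
theorem not_polyDecrementLaw_of_burgersWith {D : ℝ} (hD : 0 ≤ D) (hB : BurgersWitnessWith D)
    {p : ℝ} (hp : 0 < p) : ¬ PolyDecrementLaw p := by
  rintro ⟨c, hc, hlaw⟩
  obtain ⟨S, hS8, hlt⟩ := exists_exp_lt_polyLaw hc hp hD
  have hceil := burgers_ceilingWith hD hB hlaw hS8
  have h1 : polyLaw p c (D * S ^ 2 + 1) = c * (2 + D * S ^ 2) ^ (-p) := by
    show c * (1 + (D * S ^ 2 + 1)) ^ (-p) = _
    rw [show (1 + (D * S ^ 2 + 1) : ℝ) = 2 + D * S ^ 2 by ring]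
  rw [h1] at hceil
  linarith

/-- **EVERY POLYNOMIAL DECREMENT LAW IS FALSE** (given the Burgers facts). -/
theorem not_polyDecrementLaw_of_burgers (hB : BurgersWitness) {p : ℝ} (hp : 0 < p) :
    ¬ PolyDecrementLaw p :=
  not_polyDecrementLaw_of_burgersWith (by positivity) hB hp

/-- **EVERY EXPONENTIAL LAW WITH `θ < 1/2` IS FALSE** (given the Burgers facts with any constant
`D ≥ 0`): the exponent of the one-scale law lies in `[1/2, 8]`. -/
theorem not_expDecrementLaw_of_burgersWith {D : ℝ} (hD : 0 ≤ D) (hB : BurgersWitnessWith D)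
    {θ : ℝ} (hθ : θ < 1 / 2) : ¬ ExpDecrementLaw θ := by
  intro h
  obtain ⟨C, hC, hlaw⟩ := h.mono (le_max_left θ (1 / 4))
  have hθ0 : 0 < max θ (1 / 4) := lt_of_lt_of_le (by norm_num) (le_max_right _ _)
  have hθ1 : max θ (1 / 4) < 1 / 2 := max_lt hθ (by norm_num)
  obtain ⟨S, hS8, hlt⟩ := exists_exp_lt_expLaw hC hθ0 hθ1 hD
  have hceil := burgers_ceilingWith hD hB hlaw hS8
  have h1 : expLaw (max θ (1 / 4)) C (D * S ^ 2 + 1) =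
      Real.exp (-(C * (2 + D * S ^ 2) ^ max θ (1 / 4))) / 4 := by
    show Real.exp (-(C * (1 + (D * S ^ 2 + 1)) ^ max θ (1 / 4))) / 4 = _
    rw [show (1 + (D * S ^ 2 + 1) : ℝ) = 2 + D * S ^ 2 by ring]
  rw [h1] at hceil
  linarith

/-- **EVERY EXPONENTIAL LAW WITH `θ < 1/2` IS FALSE** (given the Burgers facts). -/
theorem not_expDecrementLaw_of_burgers (hB : BurgersWitness) {θ : ℝ} (hθ : θ < 1 / 2) :
    ¬ ExpDecrementLaw θ :=
  not_expDecrementLaw_of_burgersWith (by positivity) hB hθ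

/-- **What Chen–Tsai–Zhang's located law gives and the Burgers floor forbids, side by side**:
`ExpDecrementLaw 8` (print, proof step) ⇒ `ExpDecrementLaw θ` for all `θ ≥ 8`; the Burgers facts
(any energy constant `D ≥ 0`) ⇒ `¬ ExpDecrementLaw θ` for all `θ < 1/2` and `¬ PolyDecrementLaw p`
for all `p > 0`.  The open interval of the drift ladder is `θ ∈ [1/2, 8)`; its payoff is the
iterated-log power `1/θ ∈ (1/8, 2]` (`SwirlDecrementCalculus.expLaw_logGrowth_minorant`), never
the logarithm (`SwirlDecrementCalculus.expLaw_powerGrowth_summable`). -/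
theorem driftLadder_summaryWith {D : ℝ} (hD : 0 ≤ D) (hB : BurgersWitnessWith D)
    (hCTZ : ExpDecrementLaw 8) :
    (∀ θ : ℝ, 8 ≤ θ → ExpDecrementLaw θ) ∧ (∀ θ : ℝ, θ < 1 / 2 → ¬ ExpDecrementLaw θ) ∧
      (∀ p : ℝ, 0 < p → ¬ PolyDecrementLaw p) :=
  ⟨fun _ hθ => hCTZ.mono hθ, fun _ hθ => not_expDecrementLaw_of_burgersWith hD hB hθ,
    fun _ hp => not_polyDecrementLaw_of_burgersWith hD hB hp⟩

/-- The summary with the sharp Burgers constant. -/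
theorem driftLadder_summary (hB : BurgersWitness) (hCTZ : ExpDecrementLaw 8) :
    (∀ θ : ℝ, 8 ≤ θ → ExpDecrementLaw θ) ∧ (∀ θ : ℝ, θ < 1 / 2 → ¬ ExpDecrementLaw θ) ∧
      (∀ p : ℝ, 0 < p → ¬ PolyDecrementLaw p) :=
  driftLadder_summaryWith (by positivity) hB hCTZ

end


end Summit.NavierStokesRegularity.NavierStokesRegularity.Theorems.SwirlDecrementLaw
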